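import Literature.AlgebraicGeometry.Motives.HodgeStructureExteriorPower
import Literature.AlgebraicGeometry.HodgeTheory.WeightOneHodgeStructuresOfCurvesProofs
import Mathlib.LinearAlgebra.Eigenspace.Basic
import Mathlib.LinearAlgebra.Projection
import Mathlib.LinearAlgebra.Multilinear.Basis
import Mathlib.LinearAlgebra.TensorProduct.Basis
import HarnessLib

/-!
# The exterior powers of a weight-one Hodge structure (proofs)

This file discharges the named fact `Motives.hodgeStructure_exteriorPower_weightOne` of
`Literature/AlgebraicGeometry/Motives/HodgeStructureExteriorPower.lean` (lane `lit-hodgefound`,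
SKELETON.md row A1-12; B. van Geemen, *An introduction to the Hodge conjecture for abelian
varieties*, LNM 1594 (1994), 3.3, PDF p. 3 of the held copy: "`Hᵖ(X, ℚ) = ∧ᵖ H¹(X, ℚ)`,
`H^{p,q}(X) = (∧ᵖ H^{1,0}(X)) ⊗ (∧^q H^{0,1}(X))`"; H. Lange, *Abelian Varieties over the Complex
Numbers* (2023), §1.1.5 Prop. 1.1.23, PDF p. 26: `Hⁿ(X, ℂ) ≃ ⊕_{p+q=n} ⋀ᵖΩ ⊗ ⋀^qΩ̄`):

* `Motives.hodgeStructure_exteriorPower_weightOne_holds` — for an effective weight-one `ℚ`-Hodge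
  structure `H` on `V` (`V_ℂ = F¹ ⊕ conj F¹`), every `k` and the base-change isomorphism
  `θ : ℂ ⊗_ℚ ⋀ᵏ_ℚ V ≃ ⋀ᵏ_ℂ V_ℂ`, the filtration `θ⁻¹(wedgeFiltration (F¹ H) k p)` is a `ℚ`-Hodge
  structure of weight `k` on `⋀ᵏ_ℚ V` with `(⋀ᵏ)^{p,q} = ⋀ᵖ V^{1,0} ∧ ⋀^q V^{0,1}`.

## The argument (multilinear algebra; the printed sources state the result without proof)

Write `W = V_ℂ = S ⊕ T` with `S = F¹ = V^{1,0}`, `T = conj F¹ = V^{0,1}`.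

1. CELLS. For `A ⊆ {0, …, k-1}` let `C_A ⊆ ⋀ᵏ W` be the span of the wedges `w₁ ∧ ⋯ ∧ w_k` with
   `wᵢ ∈ S` for `i ∈ A` and `wᵢ ∈ T` for `i ∉ A`. Expanding each `wᵢ = sᵢ + tᵢ` multilinearly
   (`AlternatingMap.map_add_univ`) shows `wedgeFiltration S k p ⊆ Σ_{#A ≥ p} C_A`,
   `wedgeFiltration T k q ⊆ Σ_{#A ≤ k-q} C_A` and `⋀ᵏ W = Σ_A C_A`; conversely `C_A` lies in
   `wedgeFiltration S k p` for `#A ≥ p` and in `wedgeFiltration T k q` for `k - #A ≥ q`.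
2. GRADING. The endomorphism `φ = 1_S ⊕ 2·1_T` of `W` acts on `C_A` by `2^{k-#A}`
   (`⋀ᵏ φ`, `AlternatingMap.map_smul_univ`), so the blocks `Σ_{#A ≥ c} C_A` and `Σ_{#A < c} C_A`
   lie in sums of eigenspaces of `⋀ᵏ φ` for disjoint sets of eigenvalues and are DISJOINT
   (`Module.End.eigenspaces_iSupIndep`, `Finset.SupIndep.disjoint_sup_sup`). With 1 this gives
   `wedgeFiltration S k p ⊕ wedgeFiltration T k q = ⋀ᵏ W` for `p + q = k + 1` (opposedness) and,
   by the modular law, `wedgeFiltration S k p ∩ wedgeFiltration T k q = Σ_{#A = p} C_A` for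
   `p + q = k`; a cell with `#A = p` is the ordered span `⋀ᵖ S ∧ ⋀^q T` up to the sign of a
   permutation (`AlternatingMap.map_perm`).
3. CONJUGATION. Under `θ`, complex conjugation `conj ⊗ 1` of `ℂ ⊗_ℚ ⋀ᵏ_ℚ V` becomes
   `w₁ ∧ ⋯ ∧ w_k ↦ conj w₁ ∧ ⋯ ∧ conj w_k` (checked on a `ℚ`-basis of `V_ℂ` made of pure tensors,
   `Module.Basis.ext_multilinear`), hence `θ(conj θ⁻¹(wedgeFiltration S k q)) =
   wedgeFiltration (conj S) k q`; with `T = conj S` and `F¹ ⊕ conj F¹ = V_ℂ`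
   (`H.isCompl_F_complexConj 1 1`) steps 1–2 apply, and `V^{1,0} = F¹`, `V^{0,1} = conj F¹` for an
   effective weight-one structure (`HodgeTheory.weightOne_F_one_eq_piece`).

No new definition and no new named fact (D-0026): the cells `C A` enter the private lemmas as a
hypothesis `hC : ∀ A, C A = span {…}` instantiated by `rfl` where they are used.

## References

* B. van Geemen, *An introduction to the Hodge conjecture for abelian varieties*, LNM 1594 (1994),
  3.3 (held `paper:doi-10-1007-978-3-540-49046-3-5`, PDF p. 3). [vanGeemen1994HodgeAV]
* H. Lange, *Abelian Varieties over the Complex Numbers*, Grundlehren Text Editions (2023), §1.1.5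
  Thm. 1.1.21, Prop. 1.1.23 (held copy, PDF pp. 24–26). [Lange2023AbelianVarietiesComplex]
* P. Deligne, *Théorie de Hodge II*, Publ. Math. IHÉS 40 (1971), 1.2.5. [DeligneHodgeII1971]
-/

noncomputable section

open scoped TensorProduct

namespace Literature.AlgebraicGeometry.Motives

universe u

/-! ### Cells of `⋀ᵏ (S ⊕ T)` -/

section Cells

variable {K : Type*} [Field K] {W : Type*} [AddCommGroup W] [Module K W] {k : ℕ}

/-- A `k`-tuple with entries in `S` at all positions of `A` has at least `#A` entries in `S`.
[folklore] -/
private theorem card_le_natCard_of_mem {S : Submodule K W} {A : Finset (Fin k)} {w : Fin k → W}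
    (hw : ∀ i, i ∈ A → w i ∈ S) : (A.card : ℤ) ≤ Nat.card {i // w i ∈ S} := by
  have h := Nat.card_le_card_of_injective
    (fun a : A => (⟨a.1, hw a.1 a.2⟩ : {i // w i ∈ S}))
    (fun a b hab => Subtype.ext (by simpa using hab))
  rw [Nat.card_eq_finsetCard] at h
  exact_mod_cast h

/-- `∏ᵢ (if i ∈ A then 1 else c) = c ^ #Aᶜ`. [folklore] -/
private theorem prod_ite_mem_one_eq_pow (A : Finset (Fin k)) (c : K) :
    ∏ i, (if i ∈ A then (1 : K) else c) = c ^ Aᶜ.card := by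
  have h1 : ∏ i ∈ A, (if i ∈ A then (1 : K) else c) = 1 :=
    Finset.prod_eq_one fun i hi => by rw [if_pos hi]
  have h2 : ∏ i ∈ Aᶜ, (if i ∈ A then (1 : K) else c) = c ^ Aᶜ.card := by
    rw [← Finset.prod_const c]
    exact Finset.prod_congr rfl fun i hi => by rw [if_neg (Finset.mem_compl.1 hi)]
  rw [← Finset.prod_mul_prod_compl A, h1, h2, one_mul]

/-- `b ↦ 2ᵇ` is injective into a field of characteristic zero. [folklore] -/
private theorem two_pow_injective [CharZero K] : Function.Injective fun b : ℕ => (2 : K) ^ b := by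
  intro a b hab
  have h : ((2 ^ a : ℕ) : K) = ((2 ^ b : ℕ) : K) := by push_cast; exact hab
  exact Nat.pow_right_injective le_rfl (Nat.cast_injective h)

/-- `#Aᶜ = k - #A` as integers, for `A ⊆ Fin k`. [folklore] -/
private theorem card_compl_int (A : Finset (Fin k)) : ((Aᶜ.card : ℕ) : ℤ) = k - A.card := by
  rw [Finset.card_compl, Fintype.card_fin,
    Nat.cast_sub (A.card_le_univ.trans_eq (Fintype.card_fin k))]

/-- The ordered span `⋀ᵖ S ∧ ⋀^q T` (`p + q = k`) lies in `wedgeFiltration S k p` and in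
`wedgeFiltration T k q`. [folklore] -/
private theorem span_append_le_inf (S T : Submodule K W) {p q : ℕ} (hpq : p + q = k) :
    Submodule.span K
      {x | ∃ (u : Fin p → W) (w : Fin q → W), (∀ i, u i ∈ S) ∧ (∀ j, w j ∈ T) ∧
        exteriorPower.ιMulti K k (Fin.append u w ∘ Fin.cast hpq.symm) = x} ≤
      wedgeFiltration S k p ⊓ wedgeFiltration T k q := by
  subst hpq
  refine Submodule.span_le.2 ?_
  rintro x ⟨u, w, hu, hw, rfl⟩
  refine ⟨ιMulti_mem_wedgeFiltration S _ ?_, ιMulti_mem_wedgeFiltration T _ ?_⟩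
  · have hinj : Function.Injective fun i : Fin p =>
        (⟨Fin.castAdd q i, by simp [hu]⟩ : {i // (Fin.append u w ∘ Fin.cast rfl) i ∈ S}) :=
      fun a b hab => Fin.castAdd_injective _ _ (congrArg Subtype.val hab)
    have h := Nat.card_le_card_of_injective _ hinj
    rw [Nat.card_fin] at h
    exact_mod_cast h
  · have hinj : Function.Injective fun j : Fin q =>
        (⟨Fin.natAdd p j, by simp [hw]⟩ : {i // (Fin.append u w ∘ Fin.cast rfl) i ∈ T}) :=
      fun a b hab => Fin.natAdd_injective _ _ (congrArg Subtype.val hab)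
    have h := Nat.card_le_card_of_injective _ hinj
    rw [Nat.card_fin] at h
    exact_mod_cast h

section CellBlock

/-! In this section `C A` (`A ⊆ Fin k`) is the CELL of a pair of subspaces `S, T ⊆ W`: the span
of the wedges `w₁ ∧ ⋯ ∧ w_k` with `wᵢ ∈ S` for `i ∈ A` and `wᵢ ∈ T` for `i ∉ A` (hypothesis `hC`,
instantiated by `rfl` below; no definition is introduced). -/

variable {S T : Submodule K W} {C : Finset (Fin k) → Submodule K (⋀[K]^k W)}
  (hC : ∀ A, C A = Submodule.span K {x | ∃ w : Fin k → W,
    (∀ i, i ∈ A → w i ∈ S) ∧ (∀ i, i ∉ A → w i ∈ T) ∧ exteriorPower.ιMulti K k w = x})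

include hC

/-- A cell with `#A ≥ p` positions in `S` lies in `Fᵖ = wedgeFiltration S k p`. [folklore] -/
private theorem cell_le_wedgeFiltration_left {A : Finset (Fin k)} {p : ℤ} (hp : p ≤ A.card) :
    C A ≤ wedgeFiltration S k p := by
  rw [hC]
  refine Submodule.span_le.2 ?_
  rintro x ⟨w, hwS, -, rfl⟩
  exact ιMulti_mem_wedgeFiltration S w (hp.trans (card_le_natCard_of_mem hwS))

/-- A cell with `#Aᶜ ≥ q` positions in `T` lies in `wedgeFiltration T k q`. [folklore] -/
private theorem cell_le_wedgeFiltration_right {A : Finset (Fin k)} {q : ℤ} (hq : q ≤ Aᶜ.card) :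
    C A ≤ wedgeFiltration T k q := by
  rw [hC]
  refine Submodule.span_le.2 ?_
  rintro x ⟨w, -, hwT, rfl⟩
  exact ιMulti_mem_wedgeFiltration T w
    (hq.trans (card_le_natCard_of_mem fun i hi => hwT i (Finset.mem_compl.1 hi)))

/-- Multilinear expansion: for `sᵢ ∈ S`, `tᵢ ∈ T`, the wedge `(s₁ + t₁) ∧ ⋯ ∧ (s_k + t_k)` is the
sum over `A` of the wedges with entries `sᵢ` (`i ∈ A`) and `tᵢ` (`i ∉ A`); the terms with some
`sᵢ = 0` (`i ∈ A`) or `tᵢ = 0` (`i ∉ A`) vanish. [folklore] -/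
private theorem ιMulti_add_mem_iSup_cell (s t : Fin k → W) (hs : ∀ i, s i ∈ S)
    (ht : ∀ i, t i ∈ T) :
    exteriorPower.ιMulti K k (s + t) ∈ ⨆ (A : Finset (Fin k))
      (_ : (∀ i, i ∈ A → s i ≠ 0) ∧ ∀ i, i ∉ A → t i ≠ 0), C A := by
  rw [AlternatingMap.map_add_univ]
  refine Submodule.sum_mem _ fun A _ => ?_
  by_cases hA : (∀ i, i ∈ A → s i ≠ 0) ∧ ∀ i, i ∉ A → t i ≠ 0
  · have hmem : exteriorPower.ιMulti K k (A.piecewise s t) ∈ C A := by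
      rw [hC]
      refine Submodule.subset_span ⟨A.piecewise s t, fun i hi => ?_, fun i hi => ?_, rfl⟩
      · rw [Finset.piecewise_eq_of_mem (hi := hi)]
        exact hs i
      · rw [Finset.piecewise_eq_of_notMem (hi := hi)]
        exact ht i
    exact Submodule.mem_iSup_of_mem A (Submodule.mem_iSup_of_mem hA hmem)
  · have h0 : exteriorPower.ιMulti K k (A.piecewise s t) = 0 := by
      rcases not_and_or.1 hA with h | h <;> push Not at h
      · obtain ⟨i, hi, hsi⟩ := h
        exact AlternatingMap.map_coord_zero _ i
          (by rw [Finset.piecewise_eq_of_mem (hi := hi), hsi])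
      · obtain ⟨i, hi, hti⟩ := h
        exact AlternatingMap.map_coord_zero _ i
          (by rw [Finset.piecewise_eq_of_notMem (hi := hi), hti])
    rw [h0]
    exact Submodule.zero_mem _

/-- If `W = S ⊕ T`, then `wedgeFiltration S k p ⊆ Σ_{#A ≥ p} C_A`: split every entry of a pure
wedge as `wᵢ = sᵢ + tᵢ` (keeping `wᵢ ∈ S` whole) and expand. [folklore] -/
private theorem wedgeFiltration_le_iSup_cell (hST : IsCompl S T) (p : ℤ) :
    wedgeFiltration S k p ≤ ⨆ (A : Finset (Fin k)) (_ : p ≤ A.card), C A := by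
  classical
  refine Submodule.span_le.2 ?_
  rintro x ⟨w, hw, rfl⟩
  set s : Fin k → W := fun i => if w i ∈ S then w i else S.projection T hST (w i) with hs_def
  set t : Fin k → W := fun i => if w i ∈ S then 0 else T.projection S hST.symm (w i) with ht_def
  have hs : ∀ i, s i ∈ S := fun i => by
    by_cases h : w i ∈ S
    · simp only [hs_def, if_pos h]
      exact h
    · simp only [hs_def, if_neg h]
      exact Submodule.projection_apply_mem hST _
  have ht : ∀ i, t i ∈ T := fun i => by
    by_cases h : w i ∈ S
    · simp only [ht_def, if_pos h]
      exact T.zero_mem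
    · simp only [ht_def, if_neg h]
      exact Submodule.projection_apply_mem hST.symm _
  have hsum : s + t = w := funext fun i => by
    by_cases h : w i ∈ S
    · simp only [Pi.add_apply, hs_def, ht_def, if_pos h, add_zero]
    · simp only [Pi.add_apply, hs_def, ht_def, if_neg h]
      exact Submodule.projection_add_projection_eq_self hST (w i)
  have key := ιMulti_add_mem_iSup_cell hC s t hs ht
  rw [hsum] at key
  refine SetLike.le_def.1 (iSup₂_le fun A hA => ?_) key
  refine le_iSup₂_of_le A (hw.trans ?_) le_rfl
  have hsub : ∀ i, w i ∈ S → i ∈ A := fun i hi => by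
    by_contra hiA
    exact hA.2 i hiA (by simp only [ht_def, if_pos hi])
  have h := Nat.card_le_card_of_injective
    (fun i : {i // w i ∈ S} => (⟨i.1, hsub i.1 i.2⟩ : A))
    (fun a b hab => Subtype.ext (by simpa using hab))
  rw [Nat.card_eq_finsetCard] at h
  exact_mod_cast h

/-- If `W = S ⊕ T`, then `wedgeFiltration T k q ⊆ Σ_{#Aᶜ ≥ q} C_A` (the mirror image of
`wedgeFiltration_le_iSup_cell`, keeping the entries `wᵢ ∈ T` whole). [folklore] -/
private theorem wedgeFiltration_le_iSup_cell_right (hST : IsCompl S T) (q : ℤ) :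
    wedgeFiltration T k q ≤ ⨆ (A : Finset (Fin k)) (_ : q ≤ Aᶜ.card), C A := by
  classical
  refine Submodule.span_le.2 ?_
  rintro x ⟨w, hw, rfl⟩
  set s : Fin k → W := fun i => if w i ∈ T then 0 else S.projection T hST (w i) with hs_def
  set t : Fin k → W := fun i => if w i ∈ T then w i else T.projection S hST.symm (w i) with ht_def
  have hs : ∀ i, s i ∈ S := fun i => by
    by_cases h : w i ∈ T
    · simp only [hs_def, if_pos h]
      exact S.zero_mem
    · simp only [hs_def, if_neg h]
      exact Submodule.projection_apply_mem hST _
  have ht : ∀ i, t i ∈ T := fun i => by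
    by_cases h : w i ∈ T
    · simp only [ht_def, if_pos h]
      exact h
    · simp only [ht_def, if_neg h]
      exact Submodule.projection_apply_mem hST.symm _
  have hsum : s + t = w := funext fun i => by
    by_cases h : w i ∈ T
    · simp only [Pi.add_apply, hs_def, ht_def, if_pos h, zero_add]
    · simp only [Pi.add_apply, hs_def, ht_def, if_neg h]
      exact Submodule.projection_add_projection_eq_self hST (w i)
  have key := ιMulti_add_mem_iSup_cell hC s t hs ht
  rw [hsum] at key
  refine SetLike.le_def.1 (iSup₂_le fun A hA => ?_) key
  refine le_iSup₂_of_le A (hw.trans ?_) le_rfl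
  have hsub : ∀ i, w i ∈ T → i ∈ Aᶜ := fun i hi => by
    rw [Finset.mem_compl]
    intro hiA
    exact hA.1 i hiA (by simp only [hs_def, if_pos hi])
  have h := Nat.card_le_card_of_injective
    (fun i : {i // w i ∈ T} => (⟨i.1, hsub i.1 i.2⟩ : (Aᶜ : Finset (Fin k))))
    (fun a b hab => Subtype.ext (by simpa using hab))
  rw [Nat.card_eq_finsetCard] at h
  exact_mod_cast h

/-- If `W = S ⊕ T`, the cells span `⋀ᵏ W`. [folklore] -/
private theorem top_le_iSup_cell (hST : IsCompl S T) :
    (⊤ : Submodule K (⋀[K]^k W)) ≤ ⨆ A : Finset (Fin k), C A := by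
  rw [← wedgeFiltration_of_nonpos S k (le_refl (0 : ℤ))]
  exact (wedgeFiltration_le_iSup_cell hC hST 0).trans
    (iSup₂_le fun A _ => le_iSup_of_le A le_rfl)

/-- GRADING: the endomorphism `⋀ᵏ(1_S ⊕ c·1_T)` of `⋀ᵏ W` acts on the cell `C_A` by the scalar
`c ^ #Aᶜ`. [folklore] -/
private theorem cell_le_eigenspace (hST : IsCompl S T) (c : K) (A : Finset (Fin k)) :
    C A ≤ Module.End.eigenspace
      (exteriorPower.map k (S.projection T hST + c • T.projection S hST.symm)) (c ^ Aᶜ.card) := by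
  rw [hC]
  refine Submodule.span_le.2 ?_
  rintro x ⟨w, hwS, hwT, rfl⟩
  rw [SetLike.mem_coe, Module.End.mem_eigenspace_iff, exteriorPower.map_apply_ιMulti]
  have hφ : ⇑(S.projection T hST + c • T.projection S hST.symm) ∘ w =
      fun i => (if i ∈ A then (1 : K) else c) • w i := by
    funext i
    simp only [Function.comp_apply, LinearMap.add_apply, LinearMap.smul_apply]
    by_cases hi : i ∈ A
    · rw [if_pos hi, one_smul, Submodule.projection_apply_of_mem_left hST (hwS i hi),
        Submodule.projection_apply_of_mem_right hST.symm (hwS i hi), smul_zero, add_zero]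
    · rw [if_neg hi, Submodule.projection_apply_of_mem_right hST (hwT i hi),
        Submodule.projection_apply_of_mem_left hST.symm (hwT i hi), zero_add]
  rw [hφ, AlternatingMap.map_smul_univ, prod_ite_mem_one_eq_pow]

/-- DISJOINTNESS OF BLOCKS: if `W = S ⊕ T` (characteristic zero), the sum of the cells with
`#A ≥ c` meets the sum of the cells with `#A < c` trivially — they lie in sums of eigenspaces of
`⋀ᵏ(1_S ⊕ 2·1_T)` for disjoint sets of eigenvalues `2^{k-#A}`. [folklore] -/
private theorem disjoint_iSup_cell [CharZero K] (hST : IsCompl S T) (c : ℤ) :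
    Disjoint (⨆ (A : Finset (Fin k)) (_ : c ≤ A.card), C A)
      (⨆ (A : Finset (Fin k)) (_ : (A.card : ℤ) < c), C A) := by
  set Φ : Module.End K (⋀[K]^k W) :=
    exteriorPower.map k (S.projection T hST + (2 : K) • T.projection S hST.symm) with hΦ
  set E : ℕ → Submodule K (⋀[K]^k W) := fun b => Module.End.eigenspace Φ ((2 : K) ^ b) with hE_def
  have hE : iSupIndep E := (Module.End.eigenspaces_iSupIndep Φ).comp two_pow_injective
  have hcell : ∀ A : Finset (Fin k), C A ≤ E Aᶜ.card := fun A => cell_le_eigenspace hC hST 2 A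
  set u : Finset ℕ := (Finset.range (k + 1)).filter fun b : ℕ => (b : ℤ) ≤ k - c with hu
  set v : Finset ℕ := (Finset.range (k + 1)).filter fun b : ℕ => (k : ℤ) - c < b with hv
  have huv : Disjoint u v := by
    rw [Finset.disjoint_left]
    intro b hbu hbv
    rw [hu, Finset.mem_filter] at hbu
    rw [hv, Finset.mem_filter] at hbv
    omega
  have h := (hE.supIndep' (Finset.range (k + 1))).disjoint_sup_sup
    (Finset.filter_subset _ _) (Finset.filter_subset _ _) huv
  refine h.mono ?_ ?_
  · refine iSup₂_le fun A hA => (hcell A).trans (Finset.le_sup (f := E) ?_)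
    have := card_compl_int A
    simp only [Finset.mem_filter, Finset.mem_range]
    constructor <;> omega
  · refine iSup₂_le fun A hA => (hcell A).trans (Finset.le_sup (f := E) ?_)
    have := card_compl_int A
    simp only [Finset.mem_filter, Finset.mem_range]
    constructor <;> omega

/-- A cell with exactly `p` positions in `S` lies in the ordered span `⋀ᵖ S ∧ ⋀^q T`
(`p + q = k`): reorder the entries by a permutation, at the cost of its sign
(`AlternatingMap.map_perm`). [folklore] -/
private theorem cell_le_span_append {p q : ℕ} (hpq : p + q = k) {A : Finset (Fin k)}
    (hA : A.card = p) :
    C A ≤ Submodule.span K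
      {x | ∃ (u : Fin p → W) (w : Fin q → W), (∀ i, u i ∈ S) ∧ (∀ j, w j ∈ T) ∧
        exteriorPower.ιMulti K k (Fin.append u w ∘ Fin.cast hpq.symm) = x} := by
  classical
  rw [hC]
  subst hpq
  refine Submodule.span_le.2 ?_
  rintro x ⟨w, hwS, hwT, rfl⟩
  have hAc : Fintype.card {i // i ∉ A} = q := by
    rw [Fintype.card_subtype_compl, Fintype.card_coe, hA, Fintype.card_fin]
    omega
  set eA : A ≃ Fin p := A.equivFinOfCardEq hA with heA
  set eAc : {i // i ∉ A} ≃ Fin q := Fintype.equivFinOfCardEq hAc with heAc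
  set σ : Equiv.Perm (Fin (p + q)) :=
    finSumFinEquiv.symm.trans ((eA.symm.sumCongr eAc.symm).trans (Equiv.sumCompl fun i => i ∈ A))
    with hσ
  have hσl : ∀ i : Fin p, σ (Fin.castAdd q i) = (eA.symm i : Fin (p + q)) := fun i => by
    simp [hσ]
  have hσr : ∀ j : Fin q, σ (Fin.natAdd p j) = (eAc.symm j : Fin (p + q)) := fun j => by
    simp [hσ]
  set u : Fin p → W := fun i => w (eA.symm i) with hu
  set v : Fin q → W := fun j => w (eAc.symm j) with hv
  have happ : Fin.append u v ∘ Fin.cast (rfl : p + q = p + q).symm = w ∘ σ := by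
    funext y
    simp only [Function.comp_apply, Fin.cast_refl, id_eq]
    induction y using Fin.addCases with
    | left i => rw [Fin.append_left, hσl]
    | right j => rw [Fin.append_right, hσr]
  have key : exteriorPower.ιMulti K (p + q) w =
      Equiv.Perm.sign σ • exteriorPower.ιMulti K (p + q) (Fin.append u v ∘ Fin.cast rfl) := by
    rw [happ, AlternatingMap.map_perm, smul_smul, Int.units_mul_self, one_smul]
  rw [SetLike.mem_coe, key, Units.smul_def]
  exact Submodule.smul_of_tower_mem _ _ (Submodule.subset_span
    ⟨u, v, fun i => hwS _ (eA.symm i).2, fun j => hwT _ (eAc.symm j).2, rfl⟩)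

end CellBlock

/-- OPPOSEDNESS: if `W = S ⊕ T` (characteristic zero) and `p + q = k + 1`, then
`⋀ᵏ W = wedgeFiltration S k p ⊕ wedgeFiltration T k q`. [folklore] -/
private theorem isCompl_wedgeFiltration [CharZero K] {S T : Submodule K W} (hST : IsCompl S T)
    {p q : ℤ} (hpq : p + q = k + 1) : IsCompl (wedgeFiltration S k p) (wedgeFiltration T k q) := by
  set C : Finset (Fin k) → Submodule K (⋀[K]^k W) := fun A => Submodule.span K {x | ∃ w : Fin k → W,
    (∀ i, i ∈ A → w i ∈ S) ∧ (∀ i, i ∉ A → w i ∈ T) ∧ exteriorPower.ιMulti K k w = x} with hC_def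
  have hC : ∀ A, C A = Submodule.span K {x | ∃ w : Fin k → W,
      (∀ i, i ∈ A → w i ∈ S) ∧ (∀ i, i ∉ A → w i ∈ T) ∧ exteriorPower.ιMulti K k w = x} :=
    fun A => rfl
  refine ⟨?_, ?_⟩
  · refine (disjoint_iSup_cell hC hST p).mono (wedgeFiltration_le_iSup_cell hC hST p) ?_
    refine (wedgeFiltration_le_iSup_cell_right hC hST q).trans (iSup₂_le fun A hA => ?_)
    refine le_iSup₂_of_le A ?_ le_rfl
    have := card_compl_int A
    omega
  · rw [codisjoint_iff, eq_top_iff]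
    refine (top_le_iSup_cell hC hST).trans (iSup_le fun A => ?_)
    by_cases h : p ≤ A.card
    · exact (cell_le_wedgeFiltration_left hC h).trans le_sup_left
    · refine (cell_le_wedgeFiltration_right hC ?_).trans le_sup_right
      have := card_compl_int A
      omega

/-- THE `(p,q)` PIECE: if `W = S ⊕ T` (characteristic zero) and `p + q = k`, then
`wedgeFiltration S k p ∩ wedgeFiltration T k q = ⋀ᵖ S ∧ ⋀^q T` (the span of the wedges
`u₁ ∧ ⋯ ∧ u_p ∧ w₁ ∧ ⋯ ∧ w_q`, `uᵢ ∈ S`, `wⱼ ∈ T`). [folklore] -/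
private theorem wedgeFiltration_inf_eq_span_append [CharZero K] {S T : Submodule K W}
    (hST : IsCompl S T) {p q : ℕ} (hpq : p + q = k) :
    wedgeFiltration S k p ⊓ wedgeFiltration T k q = Submodule.span K
      {x | ∃ (u : Fin p → W) (w : Fin q → W), (∀ i, u i ∈ S) ∧ (∀ j, w j ∈ T) ∧
        exteriorPower.ιMulti K k (Fin.append u w ∘ Fin.cast hpq.symm) = x} := by
  refine le_antisymm ?_ (span_append_le_inf S T hpq)
  set C : Finset (Fin k) → Submodule K (⋀[K]^k W) := fun A => Submodule.span K {x | ∃ w : Fin k → W,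
    (∀ i, i ∈ A → w i ∈ S) ∧ (∀ i, i ∉ A → w i ∈ T) ∧ exteriorPower.ιMulti K k w = x} with hC_def
  have hC : ∀ A, C A = Submodule.span K {x | ∃ w : Fin k → W,
      (∀ i, i ∈ A → w i ∈ S) ∧ (∀ i, i ∉ A → w i ∈ T) ∧ exteriorPower.ιMulti K k w = x} :=
    fun A => rfl
  set P₀ : Submodule K (⋀[K]^k W) := ⨆ (A : Finset (Fin k)) (_ : A.card = p), C A with hP₀
  set B : Submodule K (⋀[K]^k W) := ⨆ (A : Finset (Fin k)) (_ : p < A.card), C A with hB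
  set B' : Submodule K (⋀[K]^k W) := ⨆ (A : Finset (Fin k)) (_ : A.card < p), C A with hB'
  have hS : wedgeFiltration S k p ≤ P₀ ⊔ B := by
    refine (wedgeFiltration_le_iSup_cell hC hST p).trans (iSup₂_le fun A hA => ?_)
    rcases (show p ≤ A.card by exact_mod_cast hA).eq_or_lt with h | h
    · exact le_sup_of_le_left (le_iSup₂_of_le A h.symm le_rfl)
    · exact le_sup_of_le_right (le_iSup₂_of_le A h le_rfl)
  have hT : wedgeFiltration T k q ≤ P₀ ⊔ B' := by
    refine (wedgeFiltration_le_iSup_cell_right hC hST q).trans (iSup₂_le fun A hA => ?_)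
    have := card_compl_int A
    rcases (show A.card ≤ p by omega).eq_or_lt with h | h
    · exact le_sup_of_le_left (le_iSup₂_of_le A h le_rfl)
    · exact le_sup_of_le_right (le_iSup₂_of_le A h le_rfl)
  have hd : Disjoint B (P₀ ⊔ B') := by
    refine (disjoint_iSup_cell hC hST ((p : ℤ) + 1)).mono (iSup₂_le fun A hA => ?_)
      (sup_le (iSup₂_le fun A hA => ?_) (iSup₂_le fun A hA => ?_))
    · exact le_iSup₂_of_le A (by omega) le_rfl
    · exact le_iSup₂_of_le A (by omega) le_rfl
    · exact le_iSup₂_of_le A (by omega) le_rfl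
  calc wedgeFiltration S k p ⊓ wedgeFiltration T k q
      ≤ (P₀ ⊔ B) ⊓ (P₀ ⊔ B') := inf_le_inf hS hT
    _ = P₀ ⊔ B ⊓ (P₀ ⊔ B') := sup_inf_assoc_of_le B le_sup_left
    _ = P₀ := by rw [hd.eq_bot, sup_bot_eq]
    _ ≤ _ := iSup₂_le fun A hA => cell_le_span_append hC hpq hA

end Cells

/-! ### Complex conjugation on `⋀ᵏ V_ℂ` through the base change `θ` -/

section BaseChange

open HodgeStructure

variable {V : Type u} [AddCommGroup V] [Module ℚ V] {k : ℕ}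
  {θ : ℂ ⊗[ℚ] ⋀[ℚ]^k V ≃ₗ[ℂ] ⋀[ℂ]^k (ℂ ⊗[ℚ] V)}

/-- `θ` on pure tensors with scalar entries pulled out:
`(c₁ ⊗ x₁) ∧ ⋯ ∧ (c_k ⊗ x_k) = θ((∏ cᵢ) ⊗ (x₁ ∧ ⋯ ∧ x_k))`.
[cite: BourbakiAlgebre1a3, Ch. III §7 no. 5 Prop. 8] -/
private theorem IsExteriorPowerBaseChange.ιMulti_tmul (hθ : IsExteriorPowerBaseChange θ)
    (c : Fin k → ℂ) (x : Fin k → V) :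
    exteriorPower.ιMulti ℂ k (fun i => c i ⊗ₜ[ℚ] x i) =
      θ ((∏ i, c i) ⊗ₜ[ℚ] exteriorPower.ιMulti ℚ k x) := by
  rw [hθ]
  have : (fun i => c i ⊗ₜ[ℚ] x i) = fun i => c i • ((1 : ℂ) ⊗ₜ[ℚ] x i) := by
    funext i
    rw [TensorProduct.smul_tmul', smul_eq_mul, mul_one]
  rw [this, AlternatingMap.map_smul_univ]

/-- CONJUGATION: transported through the base change `θ`, complex conjugation `conj ⊗ 1` of
`ℂ ⊗_ℚ ⋀ᵏ_ℚ V` is `w₁ ∧ ⋯ ∧ w_k ↦ conj w₁ ∧ ⋯ ∧ conj w_k` on `⋀ᵏ_ℂ V_ℂ` (both sides are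
`ℚ`-multilinear after precomposing with `conj`, and agree on pure tensors). [folklore] -/
private theorem IsExteriorPowerBaseChange.conj_symm_ιMulti (hθ : IsExteriorPowerBaseChange θ)
    (w : Fin k → ℂ ⊗[ℚ] V) :
    conj (θ.symm (exteriorPower.ιMulti ℂ k w)) =
      θ.symm (exteriorPower.ιMulti ℂ k fun i => conj (w i)) := by
  classical
  set b := (Module.Free.chooseBasis ℚ ℂ).tensorProduct (Module.Free.chooseBasis ℚ V) with hb
  set M₂ : MultilinearMap ℚ (fun _ : Fin k => ℂ ⊗[ℚ] V) (ℂ ⊗[ℚ] ⋀[ℚ]^k V) :=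
    ((θ.symm : ⋀[ℂ]^k (ℂ ⊗[ℚ] V) →ₗ[ℂ] ℂ ⊗[ℚ] ⋀[ℚ]^k V).compMultilinearMap
      (exteriorPower.ιMulti ℂ k).toMultilinearMap).restrictScalars ℚ with hM₂
  set M₁ : MultilinearMap ℚ (fun _ : Fin k => ℂ ⊗[ℚ] V) (ℂ ⊗[ℚ] ⋀[ℚ]^k V) :=
    (conj (V := ⋀[ℚ]^k V)).compMultilinearMap (M₂.compLinearMap fun _ => conj (V := V))
    with hM₁
  have hM₁_apply : ∀ z : Fin k → ℂ ⊗[ℚ] V,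
      M₁ z = conj (θ.symm (exteriorPower.ιMulti ℂ k fun i => conj (z i))) := fun z => rfl
  have hM₂_apply : ∀ z : Fin k → ℂ ⊗[ℚ] V,
      M₂ z = θ.symm (exteriorPower.ιMulti ℂ k z) := fun z => rfl
  have hM : M₁ = M₂ := by
    refine Module.Basis.ext_multilinear (fun _ => b) fun v => ?_
    rw [hM₁_apply, hM₂_apply]
    simp only [hb, Module.Basis.tensorProduct_apply', conj_tmul]
    rw [hθ.ιMulti_tmul, hθ.ιMulti_tmul, LinearEquiv.symm_apply_apply,
      LinearEquiv.symm_apply_apply, conj_tmul, ← map_prod, starRingEnd_self_apply]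
  have key : M₁ (fun i => conj (w i)) = M₂ (fun i => conj (w i)) := by rw [hM]
  rw [hM₁_apply, hM₂_apply] at key
  simp only [conj_conj] at key
  exact key

/-- Under `θ`, conjugation carries `θ⁻¹(wedgeFiltration (conj S) k q)` into
`θ⁻¹(wedgeFiltration S k q)`. [folklore] -/
private theorem IsExteriorPowerBaseChange.conj_mem_of_mem (hθ : IsExteriorPowerBaseChange θ)
    (S : Submodule ℂ (ℂ ⊗[ℚ] V)) (q : ℤ) {y : ℂ ⊗[ℚ] ⋀[ℚ]^k V}
    (hy : θ y ∈ wedgeFiltration (complexConj S) k q) :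
    θ (conj y) ∈ wedgeFiltration S k q := by
  obtain ⟨z, rfl⟩ : ∃ z, y = θ.symm z := ⟨θ y, (θ.symm_apply_apply y).symm⟩
  rw [LinearEquiv.apply_symm_apply, wedgeFiltration_def] at hy
  induction hy using Submodule.span_induction with
  | mem x hx =>
    obtain ⟨w, hw, rfl⟩ := hx
    rw [hθ.conj_symm_ιMulti, LinearEquiv.apply_symm_apply]
    exact ιMulti_mem_wedgeFiltration S _ (by simpa using hw)
  | zero => simp
  | add x x' _ _ hx hx' =>
    rw [map_add, map_add, map_add]
    exact Submodule.add_mem _ hx hx'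
  | smul a x _ hx =>
    rw [map_smul, conj_smul, map_smul]
    exact Submodule.smul_mem _ _ hx

/-- `conj (θ⁻¹ wedgeFiltration S k q) = θ⁻¹ wedgeFiltration (conj S) k q`. [folklore] -/
private theorem IsExteriorPowerBaseChange.complexConj_comap_wedgeFiltration
    (hθ : IsExteriorPowerBaseChange θ) (S : Submodule ℂ (ℂ ⊗[ℚ] V)) (q : ℤ) :
    complexConj ((wedgeFiltration S k q).comap
        (θ : ℂ ⊗[ℚ] ⋀[ℚ]^k V →ₗ[ℂ] ⋀[ℂ]^k (ℂ ⊗[ℚ] V))) =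
      (wedgeFiltration (complexConj S) k q).comap
        (θ : ℂ ⊗[ℚ] ⋀[ℚ]^k V →ₗ[ℂ] ⋀[ℂ]^k (ℂ ⊗[ℚ] V)) := by
  ext y
  simp only [mem_complexConj, Submodule.mem_comap, LinearEquiv.coe_coe]
  constructor
  · intro hy
    have h := hθ.conj_mem_of_mem (complexConj S) q (y := conj y)
      (by rwa [complexConj_complexConj])
    rwa [conj_conj] at h
  · exact fun hy => hθ.conj_mem_of_mem S q hy

end BaseChange

/-! ### The discharge -/

section Holds

open HodgeStructure

variable {V : Type u} [AddCommGroup V] [Module ℚ V] [Module.Finite ℚ V]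

/-- **van Geemen (1994), 3.3; Lange (2023), Prop. 1.1.23 — discharge of the named fact
`hodgeStructure_exteriorPower_weightOne`.** For an effective weight-one `ℚ`-Hodge structure `H`
on a finite-dimensional `V`, every `k` and the base-change isomorphism
`θ : ℂ ⊗_ℚ ⋀ᵏ_ℚ V ≃ ⋀ᵏ_ℂ V_ℂ`, the filtration `p ↦ θ⁻¹(wedgeFiltration (F¹ H) k p)` is a
`ℚ`-Hodge structure `H'` of weight `k` on `⋀ᵏ_ℚ V` with `θ(Fᵖ H') = wedgeFiltration (F¹ H) k p`
and `θ((H')^{p,q}) = ⋀ᵖ V^{1,0} ∧ ⋀^q V^{0,1}` (`p + q = k`): opposedness is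
`isCompl_wedgeFiltration` for `V_ℂ = F¹ ⊕ conj F¹` transported along `θ`
(`IsExteriorPowerBaseChange.complexConj_comap_wedgeFiltration`), the pieces are
`wedgeFiltration_inf_eq_span_append` with `V^{1,0} = F¹`, `V^{0,1} = conj F¹`
(`HodgeTheory.weightOne_F_one_eq_piece`). [cite: vanGeemen1994HodgeAV, 3.3 (PDF p. 3)] -/
theorem hodgeStructure_exteriorPower_weightOne_holds :
    hodgeStructure_exteriorPower_weightOne V := by
  intro H hH k θ hθ
  have hS : IsCompl (H.F 1) (complexConj (H.F 1)) := H.isCompl_F_complexConj 1 1 (by norm_num)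
  have hmap : ∀ p : ℤ, ((wedgeFiltration (H.F 1) k p).comap
      (θ : ℂ ⊗[ℚ] ⋀[ℚ]^k V →ₗ[ℂ] ⋀[ℂ]^k (ℂ ⊗[ℚ] V))).map
        (θ : ℂ ⊗[ℚ] ⋀[ℚ]^k V →ₗ[ℂ] ⋀[ℂ]^k (ℂ ⊗[ℚ] V)) = wedgeFiltration (H.F 1) k p :=
    fun p => Submodule.map_comap_eq_of_surjective θ.surjective _
  refine ⟨{ F := fun p => (wedgeFiltration (H.F 1) k p).comap
              (θ : ℂ ⊗[ℚ] ⋀[ℚ]^k V →ₗ[ℂ] ⋀[ℂ]^k (ℂ ⊗[ℚ] V))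
            antitone_F := fun p p' h => Submodule.comap_mono (wedgeFiltration_antitone (H.F 1) k h)
            exists_F_eq_top := ⟨0, ?_⟩
            exists_F_eq_bot := ⟨k + 1, ?_⟩
            isCompl_F_complexConj := ?_ }, hmap, ?_⟩
  · rw [wedgeFiltration_of_nonpos (H.F 1) k (le_refl (0 : ℤ)), Submodule.comap_top]
  · rw [wedgeFiltration_eq_bot_of_lt (H.F 1) (by omega : (k : ℤ) < k + 1), Submodule.comap_bot]
    exact LinearEquiv.ker θ
  · intro p q hpq
    rw [hθ.complexConj_comap_wedgeFiltration]
    exact (Submodule.orderIsoMapComap θ).symm.isCompl (isCompl_wedgeFiltration hS hpq)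
  · intro p q hpq
    have hpq' : (p : ℤ) + q = k := by exact_mod_cast hpq
    rw [HodgeStructure.piece_of_add_eq _ hpq']
    rw [hθ.complexConj_comap_wedgeFiltration, ← Submodule.comap_inf,
      Submodule.map_comap_eq_of_surjective θ.surjective,
      wedgeFiltration_inf_eq_span_append hS hpq]
    have h10 : H.piece 1 0 = H.F 1 :=
      (Literature.AlgebraicGeometry.HodgeTheory.weightOne_F_one_eq_piece H hH).symm
    have h01 : H.piece 0 1 = complexConj (H.F 1) := by
      rw [← HodgeStructure.complexConj_piece H 1 0, h10]
    rw [h10, h01]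

end Holds

end Literature.AlgebraicGeometry.Motives

end
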